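import Summits.BirchSwinnertonDyer.BirchSwinnertonDyer.Theorems.CMKolyvaginAtInertTwoKolyvaginPrimesAtTwo
import Summits.BirchSwinnertonDyer.BirchSwinnertonDyer.Theorems.CMKolyvaginAtInertTwoCMKolyvaginConjectureAtInertTwoPositiveDepthPrimeLevel
import Summits.BirchSwinnertonDyer.BirchSwinnertonDyer.Theorems.CMKolyvaginAtInertTwoCMKolyvaginConjectureAtInertTwoPositiveDepthDatumFree
import Summits.BirchSwinnertonDyer.BirchSwinnertonDyer.Theorems.CMKolyvaginAtInertTwoCMKolyvaginConjectureAtInertTwoShallowGenusDescent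
import Summits.BirchSwinnertonDyer.BirchSwinnertonDyer.Theorems.CMKolyvaginAtInertTwoCMKolyvaginConjectureAtInertTwoAllShallowGenusDescent
import HarnessLib

/-!
# Crux `CMKolyvaginConjectureAtInertTwo` (stmt-BirchSwinnertonDyer-24648), open stub `stub_positiveDepth`:
# SHALLOW CM-inert Kolyvagin primes at `2` (`ℓ ≡ 1 (mod 4)`, `M(ℓ) = 1`) EXIST beyond every bound —
# the habitat left to the crux by BSD₂ on `Σ ≥ 2` frames is NON-EMPTY and carries Kolyvagin data

Route `CMKolyvaginAtInertTwo` (cell `pub/bsd-eis`, seat `leafhand-bsd-cmkolyvaginatinert-3` g0); helper (`--supports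
stmt-BirchSwinnertonDyer-24648 --as helper`). THEOREMS ONLY (no definition, no named fact, no `sorry`); closes nothing.

CONTEXT. The cell's supply file `CMKolyvaginAtInertTwoKolyvaginPrimesAtTwo` (seat `bsd-line-cmk2-p1` g2) produces Kolyvagin
primes at `2` in the single Dirichlet class `ℓ ≡ −1 (mod 2^M·4·|d_K|·|d_F|)`: these are all DEEP (`4 ∣ ℓ + 1`, `M(ℓ) ≥ 2`).
The predecessor seat's `…DeepDivisibleOfBSDTwo` (p799717) shows that, granted `BSDp W 2` and the cell's five prints, on an
H₂ frame over a Heegner field with genus defect `Σ ≥ 2` every DEEP aligned level is `2`-divisible, so a witness of the crux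
there must contain a SHALLOW prime (`M(ℓ) < 2`, i.e. `ℓ ≡ 1 (mod 4)` by `…CanonicalFormByName`, or `Frob_ℓ ≠ Frob_∞` on
`K(E[4])`). Whether that restriction is a REFUTATION SCHEMA or a genuine residue depends on whether shallow CM-inert
Kolyvagin primes exist at all on the frame — the tree had no such supply. This file gives it:

* §1 the shallow Dirichlet class: for odd `D`, `a = 2D − 1` is a unit mod `4D` (`a² = 4D(D−1) + 1`), and a prime
  `ℓ ≡ a (mod 4D)` has `ℓ ≡ 1 (mod 4)` and `D ∣ ℓ + 1` (so `ℓ ≡ −1` modulo every divisor of `D`).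
* §2 `isKolyvaginPrime_two_shallow_of_natCast_eq` — with `D = |d_K|·|d_F|` (both odd on the crux's frame: `Odd d_K` is a
  binder, `2 ∤ d_F` is `CMInert W 2`): every prime `ℓ > N_E` in that class is a Zhang–Kolyvagin prime at `2` for `(W, K)`,
  inert in the CM field (`CMInert W ℓ`, hence `a_ℓ = 0` by Deuring), with `M(ℓ) = v₂(ℓ + 1) = 1` and `ℓ ≡ 1 (mod 4)` —
  Cox Prop. 5.16 via the cell's `isPrime_span_of_natCast_discr_eq_neg_one` / `cmInert_of_natCast_cmFieldDiscr_eq_neg_one`.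
* §3 `exists_shallow_isKolyvaginPrime_two` / `setOf_shallow_isKolyvaginPrime_two_infinite` — Dirichlet
  (Mathlib `Nat.forall_exists_prime_gt_and_eq_mod`): infinitely many such `ℓ`, beyond any bound.
* §4 `exists_shallow_prime_level_nonempty` — on the crux's frame (Heegner hypothesis, a conductor-`1` datum `d₁`): beyond
  every bound there is a shallow CM-inert Kolyvagin prime LEVEL `n = ℓ` carrying data (`Nonempty (KolyvaginHeegnerData Dt β ι ℓ)`,
  predecessor's `nonempty_kolyvaginHeegnerData_of_kolyvaginPrimes`), on which the crux's clause is datum-free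
  (`exists_iff_forall_primitive_prime`, p796080): `(∃ d, P_d(ℓ) ∉ 2E(K[ℓ])) ↔ (∀ d, P_d(ℓ) ∉ 2E(K[ℓ]))`.
* §5 `exists_shallow_prime_level_anti_form` — on H₂ (`ρ̄_{E,2}` onto as well): beyond every bound a shallow CM-inert
  Kolyvagin prime level `ℓ` with data on which, for EVERY datum `d`, the crux's clause `P_d(ℓ) ∉ 2E(K[ℓ])` reads
  «no `⟨σ_ℓ²⟩`-fixed, `σ_ℓ`-anti point `Q` of `E(K[ℓ])` has `2Q = g_d`», `g_d = Σ_{s∈S} s(Σ_{k<(ℓ+1)/2} σ_ℓ^{2k} y(ℓ))` the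
  genus point (predecessor's `two_dvd_derivedPoint_iff_exists_anti_of_shallow`, p800829) — i.e. the habitat that p799717
  leaves to the crux under BSD₂ on `Σ ≥ 2` frames (shallow classes `c₁(ℓ) ∈ H¹(K, E[2])`) is NON-EMPTY on every frame and
  its clause there is a level-one `2`-indivisibility in the genus-twist family `E(L_ℓ)^−`, `ℓ ≡ 1 (mod 4)`: a residue, not a
  refutation schema.

HONEST FRAMING: Deuring + Dirichlet + compositions of tree theorems; the mathematics of `stub_positiveDepth` (Kolyvagin's
non-vanishing mod `2` at CM-inert `2`; no printed source — Kolyvagin 1991 / W. Zhang 2014 need `p` odd, non-CM) is untouched.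
No stub or item is closed; BSD is proved for no curve. Beyond-print theorem: no.

References: [cite: Cox2013, §1.C Lemma 1.14, §5.B Prop. 5.16] [cite: Lang1987, Ch. 13 §4 Thm. 12 (Deuring)]
[cite: GrossLMS1991, §3 (3.1)–(3.3), §4 (4.1)] [cite: WZhang2014, Notations (xii), §3.7] ; Dirichlet (Mathlib `PrimesInAP`).
-/

set_option linter.dupNamespace false -- `Summit.BirchSwinnertonDyer.BirchSwinnertonDyer.Theorems.…` (summit = sub)
set_option autoImplicit false

noncomputable section

open scoped Classical

namespace Summit.BirchSwinnertonDyer.BirchSwinnertonDyer.Theorems.CMKolyvaginConjecturePositiveDepth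

open WeierstrassCurve NumberField Literature.NumberTheory.EllipticCurves
  Literature.NumberTheory.EllipticCurves.ModularForms
  Literature.NumberTheory.EllipticCurves.Rank1Residual
open Summit.BirchSwinnertonDyer.BirchSwinnertonDyer.Theorems.CMKolyvaginPrimes
open Summit.BirchSwinnertonDyer.BirchSwinnertonDyer.Theses.CMKolyvaginAtInertTwo (CMKolyvaginConjectureAtInertTwo)

/-! ## §1 The shallow Dirichlet class `2D − 1 (mod 4D)` for odd `D` -/

/-- For `D ≥ 1`, `(2D − 1)² = 4D(D − 1) + 1 ≡ 1 (mod 4D)`: the class `2D − 1` is an involution of `ℤ/4D`. [folklore] -/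
theorem natCast_two_mul_sub_one_mul_self {D : ℕ} (hD : 0 < D) :
    ((2 * D - 1 : ℕ) : ZMod (4 * D)) * ((2 * D - 1 : ℕ) : ZMod (4 * D)) = 1 := by
  obtain ⟨e, rfl⟩ : ∃ e, D = e + 1 := ⟨D - 1, by omega⟩
  have h1 : 2 * (e + 1) - 1 = 2 * e + 1 := by omega
  have h2 : (2 * e + 1) * (2 * e + 1) = (4 * (e + 1)) * e + 1 := by ring
  rw [h1, ← Nat.cast_mul, h2, Nat.cast_add, Nat.cast_mul, ZMod.natCast_self, zero_mul, zero_add, Nat.cast_one]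

/-- For `D ≥ 1` the class `2D − 1` is a unit of `ℤ/4D` (its own inverse). [folklore] -/
theorem isUnit_natCast_two_mul_sub_one {D : ℕ} (hD : 0 < D) :
    IsUnit ((2 * D - 1 : ℕ) : ZMod (4 * D)) :=
  IsUnit.of_mul_eq_one _ (natCast_two_mul_sub_one_mul_self hD)

/-- For odd `D`, a natural number `ℓ ≡ 2D − 1 (mod 4D)` has `ℓ ≡ 1 (mod 4)` (`2D − 1 = 4k + 1` for `D = 2k + 1`). [folklore] -/
theorem mod_four_eq_one_of_natCast_eq {D ℓ : ℕ} (hD : Odd D)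
    (h : (ℓ : ZMod (4 * D)) = ((2 * D - 1 : ℕ) : ZMod (4 * D))) : ℓ % 4 = 1 := by
  have hmod : ℓ ≡ 2 * D - 1 [MOD 4 * D] := (ZMod.natCast_eq_natCast_iff _ _ _).mp h
  have h4 : ℓ ≡ 2 * D - 1 [MOD 4] := hmod.of_mul_right D
  obtain ⟨k, rfl⟩ := hD
  have hk : (2 * (2 * k + 1) - 1) % 4 = 1 := by omega
  unfold Nat.ModEq at h4
  omega

/-- For `D ≥ 1`, a natural number `ℓ ≡ 2D − 1 (mod 4D)` has `D ∣ ℓ + 1`. [folklore] -/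
theorem dvd_add_one_of_natCast_eq {D ℓ : ℕ} (hD : 0 < D)
    (h : (ℓ : ZMod (4 * D)) = ((2 * D - 1 : ℕ) : ZMod (4 * D))) : D ∣ ℓ + 1 := by
  have hmod : ℓ ≡ 2 * D - 1 [MOD 4 * D] := (ZMod.natCast_eq_natCast_iff _ _ _).mp h
  have hD' : ℓ + 1 ≡ 2 * D - 1 + 1 [MOD D] := (hmod.of_mul_left 4).add_right 1
  have h3 : 2 * D - 1 + 1 = D * 2 := by omega
  rw [h3] at hD'
  exact Nat.modEq_zero_iff_dvd.mp (hD'.trans (Nat.modEq_zero_iff_dvd.mpr (dvd_mul_right D 2)))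

/-- `d ∣ ℓ + 1` gives `ℓ ≡ −1 (mod d)` in `ZMod d`. [folklore] -/
theorem natCast_eq_neg_one_of_dvd_add_one {d ℓ : ℕ} (h : d ∣ ℓ + 1) : (ℓ : ZMod d) = -1 := by
  have h0 : ((ℓ + 1 : ℕ) : ZMod d) = 0 := (ZMod.natCast_eq_zero_iff _ _).mpr h
  rw [Nat.cast_add, Nat.cast_one] at h0
  exact eq_neg_of_add_eq_zero_left h0

/-- `ℓ ≡ 1 (mod 4)` gives `v₂(ℓ + 1) = 1`. [folklore] -/
theorem padicValNat_two_add_one_eq_one_of_mod_four_eq_one {ℓ : ℕ} (h : ℓ % 4 = 1) :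
    padicValNat 2 (ℓ + 1) = 1 := by
  haveI : Fact (Nat.Prime 2) := ⟨Nat.prime_two⟩
  have h2 : 2 ∣ ℓ + 1 := by omega
  have h4 : ¬ 2 ^ 2 ∣ ℓ + 1 := by omega
  have hge : 1 ≤ padicValNat 2 (ℓ + 1) := one_le_padicValNat_of_dvd (by omega) h2
  have hlt : ¬ 2 ≤ padicValNat 2 (ℓ + 1) := fun hle ↦ h4 ((padicValNat_dvd_iff_le (by omega)).mpr hle)
  omega

/-! ## §2 Shallow CM-inert Kolyvagin primes at `2` -/

variable (W : WeierstrassCurve ℚ) [W.IsElliptic]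

/-- On the crux's habitat `2` is unramified in the CM field: `CMInert W 2` gives `d_F` odd (`|d_F|` odd). [folklore] -/
theorem odd_natAbs_cmFieldDiscrOfJ_of_cmInert_two (hin : CMInert W 2) : Odd (cmFieldDiscrOfJ W.j).natAbs := by
  rcases Nat.even_or_odd (cmFieldDiscrOfJ W.j).natAbs with h | h
  · exact absurd (Int.ofNat_dvd_left.mpr (even_iff_two_dvd.mp h)) hin.1
  · exact h

variable [W.IsGloballyMinimal]

/-- **Every prime `ℓ > N_E` in the shallow class `ℓ ≡ 2D − 1 (mod 4D)`, `D = |d_K|·|d_F|`, is a SHALLOW CM-inert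
Zhang–Kolyvagin prime at `2`** for `(W, K)` (`W` globally minimal with CM and `2` inert in `F`, `K` imaginary quadratic with
odd `d_K`): `IsKolyvaginPrime N_E W K 2 ℓ`, `CMInert W ℓ`, `a_ℓ = 0`, `M(ℓ) = 1`, `ℓ ≡ 1 (mod 4)`. Indeed `ℓ ≡ −1 (mod |d_K|)`
and `ℓ ≡ −1 (mod |d_F|)` make `ℓ` inert in `K` and in `F` (Cox Prop. 5.16, `χ_D(−1) = −1` for `D < 0`), Deuring gives
`a_ℓ = 0`, so `M(ℓ) = v₂(ℓ + 1) = 1` as `ℓ ≡ 1 (mod 4)`.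
[cite: Cox2013, §5.B Prop. 5.16] [cite: Lang1987, Ch. 13 §4 Thm. 12] [cite: WZhang2014, Notations (xii)] -/
theorem isKolyvaginPrime_two_shallow_of_natCast_eq (hCM : W.HasCM) (hin : CMInert W 2) {K : Type} [Field K]
    [NumberField K] (hK : IsImaginaryQuadratic K) (hodd : Odd (NumberField.discr K)) {ℓ : ℕ}
    (hℓ : ℓ.Prime) (hNℓ : W.conductorNorm ℤ < ℓ)
    (h : (ℓ : ZMod (4 * ((NumberField.discr K).natAbs * (cmFieldDiscrOfJ W.j).natAbs))) =
      ((2 * ((NumberField.discr K).natAbs * (cmFieldDiscrOfJ W.j).natAbs) - 1 : ℕ) :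
        ZMod (4 * ((NumberField.discr K).natAbs * (cmFieldDiscrOfJ W.j).natAbs)))) :
    Zhang2014.IsKolyvaginPrime (W.conductorNorm ℤ) W K 2 ℓ ∧ CMInert W ℓ ∧ W.frobeniusTrace ℓ = 0 ∧
      Zhang2014.kolyvaginIndex W 2 ℓ = 1 ∧ ℓ % 4 = 1 := by
  set D : ℕ := (NumberField.discr K).natAbs * (cmFieldDiscrOfJ W.j).natAbs with hD_def
  haveI := Fact.mk hℓ
  have hDodd : Odd D := (Int.natAbs_odd.mpr hodd).mul (odd_natAbs_cmFieldDiscrOfJ_of_cmInert_two W hin)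
  have hD0 : 0 < D := hDodd.pos
  have hℓ4 : ℓ % 4 = 1 := mod_four_eq_one_of_natCast_eq hDodd h
  have hℓ2 : ℓ ≠ 2 := by omega
  have hDℓ : D ∣ ℓ + 1 := dvd_add_one_of_natCast_eq hD0 h
  have hKℓ : (ℓ : ZMod (NumberField.discr K).natAbs) = -1 :=
    natCast_eq_neg_one_of_dvd_add_one (dvd_trans (dvd_mul_right _ _) hDℓ)
  have hFℓ : (ℓ : ZMod (cmFieldDiscrOfJ W.j).natAbs) = -1 :=
    natCast_eq_neg_one_of_dvd_add_one (dvd_trans (dvd_mul_left _ _) hDℓ)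
  have hNdvd : ¬ ℓ ∣ W.conductorNorm ℤ := fun hd ↦
    absurd (Nat.le_of_dvd W.conductorNorm_pos_holds hd) (not_le.mpr hNℓ)
  have hgood : W.HasGoodReductionAtPrime ℓ := by
    by_contra hbad
    exact hNdvd ((dvd_conductorNorm_iff_not_hasGoodReductionAtPrime (W := W) ℓ).mpr hbad)
  obtain ⟨hinert, hdK⟩ := isPrime_span_of_natCast_discr_eq_neg_one hK hℓ hℓ2 hKℓ
  have hcmℓ : CMInert W ℓ := cmInert_of_natCast_cmFieldDiscr_eq_neg_one W hCM hℓ hℓ2 hFℓ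
  have ha : W.frobeniusTrace ℓ = 0 :=
    frobeniusTrace_eq_zero_of_natCast_cmFieldDiscr_eq_neg_one W hCM hℓ2 hgood hFℓ
  have hidx : Zhang2014.kolyvaginIndex W 2 ℓ = 1 := by
    rw [kolyvaginIndex_two_eq_of_frobeniusTrace_eq_zero W ha, padicValNat_two_add_one_eq_one_of_mod_four_eq_one hℓ4]
  refine ⟨⟨hℓ, hNdvd, hdK, hℓ2, hinert, ?_⟩, hcmℓ, ha, hidx, hℓ4⟩
  rw [hidx]
  exact Nat.one_pos

/-! ## §3 Supply beyond every bound (Dirichlet) -/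

/-- **Shallow CM-inert Kolyvagin primes at `2` exist beyond any bound**: for `W/ℚ` globally minimal with CM and `2` inert in
the CM field and `K` imaginary quadratic with odd `d_K`, for every `n` there is a prime `ℓ > n` with
`IsKolyvaginPrime N_E W K 2 ℓ`, `CMInert W ℓ`, `a_ℓ = 0`, `M(ℓ) = 1` and `ℓ ≡ 1 (mod 4)` — Dirichlet's theorem in the class
`ℓ ≡ 2D − 1 (mod 4D)`, `D = |d_K|·|d_F|`. [cite: Cox2013, §5.B Prop. 5.16] [cite: Lang1987, Ch. 13 §4 Thm. 12] -/
theorem exists_shallow_isKolyvaginPrime_two (hCM : W.HasCM) (hin : CMInert W 2) {K : Type} [Field K]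
    [NumberField K] (hK : IsImaginaryQuadratic K) (hodd : Odd (NumberField.discr K)) (n : ℕ) :
    ∃ ℓ : ℕ, n < ℓ ∧ Zhang2014.IsKolyvaginPrime (W.conductorNorm ℤ) W K 2 ℓ ∧ CMInert W ℓ ∧
      W.frobeniusTrace ℓ = 0 ∧ Zhang2014.kolyvaginIndex W 2 ℓ = 1 ∧ ℓ % 4 = 1 := by
  set D : ℕ := (NumberField.discr K).natAbs * (cmFieldDiscrOfJ W.j).natAbs with hD_def
  have hDodd : Odd D := (Int.natAbs_odd.mpr hodd).mul (odd_natAbs_cmFieldDiscrOfJ_of_cmInert_two W hin)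
  have hD0 : 0 < D := hDodd.pos
  haveI : NeZero (4 * D) := ⟨by omega⟩
  obtain ⟨ℓ, hℓgt, hℓ, hℓm⟩ := Nat.forall_exists_prime_gt_and_eq_mod
    (isUnit_natCast_two_mul_sub_one hD0) (max n (W.conductorNorm ℤ))
  simp only [gt_iff_lt, max_lt_iff] at hℓgt
  exact ⟨ℓ, hℓgt.1, isKolyvaginPrime_two_shallow_of_natCast_eq W hCM hin hK hodd hℓ hℓgt.2 hℓm⟩

/-- **The set of shallow CM-inert Kolyvagin primes at `2` is infinite** (same content, `Set.Infinite` form).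
[cite: Cox2013, §5.B Prop. 5.16] [cite: Lang1987, Ch. 13 §4 Thm. 12] -/
theorem setOf_shallow_isKolyvaginPrime_two_infinite (hCM : W.HasCM) (hin : CMInert W 2) {K : Type} [Field K]
    [NumberField K] (hK : IsImaginaryQuadratic K) (hodd : Odd (NumberField.discr K)) :
    {ℓ : ℕ | Zhang2014.IsKolyvaginPrime (W.conductorNorm ℤ) W K 2 ℓ ∧ CMInert W ℓ ∧
      Zhang2014.kolyvaginIndex W 2 ℓ = 1 ∧ ℓ % 4 = 1}.Infinite := by
  refine Set.infinite_of_forall_exists_gt fun n ↦ ?_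
  obtain ⟨ℓ, hn, hKol, hcm, -, hidx, h4⟩ := exists_shallow_isKolyvaginPrime_two W hCM hin hK hodd n
  exact ⟨ℓ, ⟨hKol, hcm, hidx, h4⟩, hn⟩

/-- **Both depth classes are populated**: besides the shallow primes, for every `M` and every bound there is a DEEP CM-inert
Kolyvagin prime `ℓ' > n` with `2^M ∣ ℓ' + 1` (the cell's `exists_isKolyvaginPrime_two_depth`, here also recorded with
`CMInert W ℓ'` via `cmInert_of_isKolyvaginPrime_two`-free means: `a_{ℓ'} = 0` and `M ≤ M(ℓ')`). Recorded so that the crux's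
two regimes (deep: Kolyvagin's `M`-descent; shallow: genus classes `c₁`) are both non-empty on every frame.
[cite: WZhang2014, Notations (xii)] [cite: Cox2013, §5.B Prop. 5.16] -/
theorem exists_shallow_and_deep_isKolyvaginPrime_two (hCM : W.HasCM) (hin : CMInert W 2) {K : Type} [Field K]
    [NumberField K] (hK : IsImaginaryQuadratic K) (hodd : Odd (NumberField.discr K)) (M n : ℕ) :
    (∃ ℓ : ℕ, n < ℓ ∧ Zhang2014.IsKolyvaginPrime (W.conductorNorm ℤ) W K 2 ℓ ∧ CMInert W ℓ ∧
        Zhang2014.kolyvaginIndex W 2 ℓ = 1) ∧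
      ∃ ℓ' : ℕ, n < ℓ' ∧ Zhang2014.IsKolyvaginPrime (W.conductorNorm ℤ) W K 2 ℓ' ∧ 2 ^ M ∣ ℓ' + 1 ∧
        M ≤ Zhang2014.kolyvaginIndex W 2 ℓ' := by
  obtain ⟨ℓ, hn, hKol, hcm, -, hidx, -⟩ := exists_shallow_isKolyvaginPrime_two W hCM hin hK hodd n
  obtain ⟨ℓ', hn', hKol', h2M, -, hM⟩ := exists_isKolyvaginPrime_two_depth W hCM hK M n
  exact ⟨⟨ℓ, hn, hKol, hcm, hidx⟩, ℓ', hn', hKol', h2M, hM⟩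

/-! ## §4 On the crux's frame: shallow prime LEVELS carrying Kolyvagin data, datum-free clause -/

/-- **Shallow admissible prime levels with data exist beyond every bound on the crux's frame.** For `W/ℚ` globally minimal
with CM, `2` inert in `F`, `K` imaginary quadratic with odd `d_K` satisfying the Heegner hypothesis for `N_E`, a frame
`(Dt, β, ι)` with a conductor-`1` datum `d₁`: for every `B` there is a prime `ℓ > B` which is a CM-inert Zhang–Kolyvagin prime
at `2` with `M(ℓ) = 1 < 2` (`ℓ ≡ 1 (mod 4)`), the level `n = ℓ` is square-free with all prime factors of that kind, and
`KolyvaginHeegnerData Dt β ι ℓ` is inhabited (predecessor's `nonempty_kolyvaginHeegnerData_of_kolyvaginPrimes`: the CM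
rationality of `y(ℓ)` and generators of `G_ℓ` are tree theorems). [cite: GrossLMS1991, §3–§4 (4.1)] [cite: WZhang2014, §3.7] -/
theorem exists_shallow_prime_level_nonempty [NeZero (W.conductorNorm ℤ)] (hCM : W.HasCM) (hin : CMInert W 2)
    {K : Type} [Field K] [NumberField K] (hK : IsImaginaryQuadratic K) (hodd : Odd (NumberField.discr K))
    (hH : SatisfiesHeegnerHypothesis (W.conductorNorm ℤ) K)
    (Dt : ModularParametrizationData W (W.conductorNorm ℤ)) {β : ℤ} (ι : K →+* ℂ)
    (d₁ : KolyvaginHeegnerData Dt β ι 1) (B : ℕ) :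
    ∃ ℓ : ℕ, B < ℓ ∧ ℓ.Prime ∧ ℓ % 4 = 1 ∧ Zhang2014.kolyvaginIndex W 2 ℓ = 1 ∧ Squarefree ℓ ∧
      (∀ q ∈ ℓ.primeFactors, Zhang2014.IsKolyvaginPrime (W.conductorNorm ℤ) W K 2 q ∧ CMInert W q ∧
        Zhang2014.kolyvaginIndex W 2 q < 2) ∧
      Nonempty (KolyvaginHeegnerData Dt β ι ℓ) := by
  obtain ⟨ℓ, hB, hKol, hcm, -, hidx, h4⟩ := exists_shallow_isKolyvaginPrime_two W hCM hin hK hodd B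
  have hℓ : ℓ.Prime := hKol.1
  have hpf : ∀ q ∈ ℓ.primeFactors, q = ℓ := fun q hq ↦ by
    rw [hℓ.primeFactors, Finset.mem_singleton] at hq
    exact hq
  have hall : ∀ q ∈ ℓ.primeFactors, Zhang2014.IsKolyvaginPrime (W.conductorNorm ℤ) W K 2 q ∧ CMInert W q ∧
      Zhang2014.kolyvaginIndex W 2 q < 2 := fun q hq ↦ by
    rw [hpf q hq, hidx]
    exact ⟨hKol, hcm, by omega⟩
  refine ⟨ℓ, hB, hℓ, h4, hidx, hℓ.squarefree, hall, ?_⟩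
  exact nonempty_kolyvaginHeegnerData_of_kolyvaginPrimes W hK hH Dt ι d₁ hℓ.squarefree (fun q hq ↦ (hall q hq).1)

/-- **At such a shallow prime level the crux's clause is datum-free** (predecessor's `exists_iff_forall_primitive_prime`,
p796080): on the frame (odd `d_K ≠ −3`, Heegner), for the shallow CM-inert Kolyvagin prime `ℓ` supplied above,
«some datum of conductor `ℓ` has `P(ℓ) ∉ 2E(K[ℓ])`» iff «every datum has» — so the surviving (BSD-compatible) clause of
the crux at level `ℓ` is ONE statement about the frame, not about choices. [cite: GrossLMS1991, §4 (4.1)] [cite: WZhang2014, §3.7] -/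
theorem exists_shallow_prime_level_datumFree [NeZero (W.conductorNorm ℤ)] (hCM : W.HasCM) (hin : CMInert W 2)
    {K : Type} [Field K] [NumberField K] (hK : IsImaginaryQuadratic K) (hodd : Odd (NumberField.discr K))
    (h3 : NumberField.discr K ≠ -3) (hH : SatisfiesHeegnerHypothesis (W.conductorNorm ℤ) K)
    (Dt : ModularParametrizationData W (W.conductorNorm ℤ)) {β : ℤ} (ι : K →+* ℂ)
    (d₁ : KolyvaginHeegnerData Dt β ι 1) (B : ℕ) :
    ∃ ℓ : ℕ, B < ℓ ∧ ℓ.Prime ∧ ℓ % 4 = 1 ∧ Zhang2014.IsKolyvaginPrime (W.conductorNorm ℤ) W K 2 ℓ ∧ CMInert W ℓ ∧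
      Zhang2014.kolyvaginIndex W 2 ℓ = 1 ∧ Nonempty (KolyvaginHeegnerData Dt β ι ℓ) ∧
      ((∃ d : KolyvaginHeegnerData Dt β ι ℓ,
          ¬ ∃ Q : (W.baseChange (ringClassField K ι ℓ)).toAffine.Point, (2 : ℤ) • Q = d.derivedPoint) ↔
        ∀ d : KolyvaginHeegnerData Dt β ι ℓ,
          ¬ ∃ Q : (W.baseChange (ringClassField K ι ℓ)).toAffine.Point, (2 : ℤ) • Q = d.derivedPoint) := by
  obtain ⟨ℓ, hB, hℓ, h4, hidx, -, hall, hne⟩ :=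
    exists_shallow_prime_level_nonempty W hCM hin hK hodd hH Dt ι d₁ B
  have hmem : ℓ ∈ ℓ.primeFactors := by
    rw [hℓ.primeFactors, Finset.mem_singleton]
  obtain ⟨hKol, hcm, -⟩ := hall ℓ hmem
  refine ⟨ℓ, hB, hℓ, h4, hKol, hcm, hidx, hne, ?_⟩
  exact exists_iff_forall_primitive_prime W hCM hK hodd h3 hH d₁ hKol hcm

/-! ## §5 On H₂: the clause at a supplied shallow level in genus-twist (anti-invariant) form -/

/-- **Beyond every bound, a shallow CM-inert Kolyvagin prime level whose clause is a genus-twist statement.** On H₂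
(`W/ℚ` globally minimal with CM, `2` inert in `F`, `ρ̄_{E,2}` onto), `K` imaginary quadratic with odd `d_K ≠ −3` and Heegner
for `N_E`, a frame `(Dt, β, ι)` with a conductor-`1` datum: for every `B` there is a prime `ℓ > B`, `ℓ ≡ 1 (mod 4)`, which is
a CM-inert Zhang–Kolyvagin prime at `2` with `M(ℓ) = 1`, with `KolyvaginHeegnerData Dt β ι ℓ` inhabited, and such that for
EVERY datum `d` of conductor `ℓ`: **`P_d(ℓ) ∉ 2E(K[ℓ]) ⟺ ¬ ∃ Q, σ_ℓ²Q = Q ∧ σ_ℓQ = −Q ∧ 2Q = g_d`**, `g_d` the genus point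
(p800829 `two_dvd_derivedPoint_iff_exists_anti_of_shallow` at the supplied `ℓ`). [cite: GrossLMS1991, §3 (3.5), §4 (4.1)]
[cite: WZhang2014, §3.7 (M(ℓ))] [cite: Cox2013, §5.B Prop. 5.16, §9.A] -/
theorem exists_shallow_prime_level_anti_form [NeZero (W.conductorNorm ℤ)] (hCM : W.HasCM) (hin : CMInert W 2)
    (hρ : W.HasSurjectiveModNGaloisRep (2 : ℤ))
    {K : Type} [Field K] [NumberField K] (hK : IsImaginaryQuadratic K) (hodd : Odd (NumberField.discr K))
    (h3 : NumberField.discr K ≠ -3) (hH : SatisfiesHeegnerHypothesis (W.conductorNorm ℤ) K)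
    (Dt : ModularParametrizationData W (W.conductorNorm ℤ)) {β : ℤ} (ι : K →+* ℂ)
    (d₁ : KolyvaginHeegnerData Dt β ι 1) (B : ℕ) :
    ∃ ℓ : ℕ, B < ℓ ∧ ℓ.Prime ∧ ℓ % 4 = 1 ∧ Zhang2014.IsKolyvaginPrime (W.conductorNorm ℤ) W K 2 ℓ ∧ CMInert W ℓ ∧
      Zhang2014.kolyvaginIndex W 2 ℓ = 1 ∧ Nonempty (KolyvaginHeegnerData Dt β ι ℓ) ∧
      ∀ d : KolyvaginHeegnerData Dt β ι ℓ,
        ((¬ ∃ Q : (W.baseChange (ringClassField K ι ℓ)).toAffine.Point, (2 : ℤ) • Q = d.derivedPoint) ↔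
          ¬ ∃ Q : (W.baseChange (ringClassField K ι ℓ)).toAffine.Point,
            pointGalHom W (ringClassField K ι ℓ) (d.σ ℓ ^ 2) Q = Q ∧
            pointGalHom W (ringClassField K ι ℓ) (d.σ ℓ) Q = -Q ∧ (2 : ℤ) • Q =
              ∑ s ∈ d.S, pointGalHom W (ringClassField K ι ℓ) s
                (∑ k ∈ Finset.range ((ℓ + 1) / 2), pointGalHom W (ringClassField K ι ℓ) ((d.σ ℓ ^ 2) ^ k) d.y)) := by
  obtain ⟨ℓ, hB, hℓ, h4, hKol, hcm, hidx, hne, -⟩ :=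
    exists_shallow_prime_level_datumFree W hCM hin hK hodd h3 hH Dt ι d₁ B
  refine ⟨ℓ, hB, hℓ, h4, hKol, hcm, hidx, hne, fun d ↦ ?_⟩
  exact not_congr (two_dvd_derivedPoint_iff_exists_anti_of_shallow W hCM hin hρ hK hodd h3 hH hKol hcm h4 d)

/-! ## §6 Composite ALL-SHALLOW levels of every length (appended, same seat) -/

/-- **Square-free ALL-SHALLOW admissible levels of every length exist beyond every bound**: for `W/ℚ` globally minimal
with CM and `2` inert in `F`, `K` imaginary quadratic with odd `d_K`, and all `r, B`: there is a square-free `n` with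
exactly `r` prime factors, each `> B` and each a CM-inert Zhang–Kolyvagin prime at `2` with `M(q) = 1`, `q ≡ 1 (mod 4)`
(induction on `r`, multiplying by a fresh shallow prime beyond `max B n`). These are the levels of the predecessor's
ALL-SHALLOW composite descent (p801497 `two_dvd_derivedPoint_iff_exists_forall_anti_of_allShallow`), which is thereby
non-vacuous at every length. [cite: Cox2013, §5.B Prop. 5.16] [cite: WZhang2014, Notations (xii), §3.7 (Λ)] -/
theorem exists_squarefree_allShallow_level (hCM : W.HasCM) (hin : CMInert W 2) {K : Type} [Field K]
    [NumberField K] (hK : IsImaginaryQuadratic K) (hodd : Odd (NumberField.discr K)) (r B : ℕ) :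
    ∃ n : ℕ, Squarefree n ∧ n.primeFactors.card = r ∧
      ∀ q ∈ n.primeFactors, B < q ∧ Zhang2014.IsKolyvaginPrime (W.conductorNorm ℤ) W K 2 q ∧ CMInert W q ∧
        Zhang2014.kolyvaginIndex W 2 q = 1 ∧ q % 4 = 1 := by
  induction r with
  | zero => exact ⟨1, squarefree_one, by simp, by simp⟩
  | succ r ih =>
    obtain ⟨n, hn, hcard, hall⟩ := ih
    have hn0 : n ≠ 0 := hn.ne_zero
    obtain ⟨ℓ, hℓgt, hKol, hcm, -, hidx, h4⟩ := exists_shallow_isKolyvaginPrime_two W hCM hin hK hodd (max B n)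
    have hℓ : ℓ.Prime := hKol.1
    have hBℓ : B < ℓ := lt_of_le_of_lt (le_max_left _ _) hℓgt
    have hnℓ : n < ℓ := lt_of_le_of_lt (le_max_right _ _) hℓgt
    have hndvd : ¬ ℓ ∣ n := fun h ↦ absurd (Nat.le_of_dvd (Nat.pos_of_ne_zero hn0) h) (not_le.mpr hnℓ)
    have hcop : Nat.Coprime ℓ n := hℓ.coprime_iff_not_dvd.mpr hndvd
    have hℓmem : ℓ ∉ n.primeFactors := fun hmem ↦ hndvd (Nat.dvd_of_mem_primeFactors hmem)
    refine ⟨ℓ * n, (Nat.squarefree_mul hcop).mpr ⟨hℓ.squarefree, hn⟩, ?_, ?_⟩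
    · rw [Nat.primeFactors_mul hℓ.ne_zero hn0, hℓ.primeFactors,
        Finset.card_union_of_disjoint (Finset.disjoint_singleton_left.mpr hℓmem), Finset.card_singleton, hcard,
        add_comm]
    · intro q hq
      rw [Nat.primeFactors_mul hℓ.ne_zero hn0, Finset.mem_union, hℓ.primeFactors, Finset.mem_singleton] at hq
      rcases hq with rfl | hq
      · exact ⟨hBℓ, hKol, hcm, hidx, h4⟩
      · exact hall q hq

/-- **… and they carry Kolyvagin data on the crux's frame** (Heegner hypothesis, a conductor-`1` datum): for all `r, B` a
square-free all-shallow admissible level `n` with `r` prime factors `> B` and `Nonempty (KolyvaginHeegnerData Dt β ι n)`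
(predecessor's `nonempty_kolyvaginHeegnerData_of_kolyvaginPrimes`). [cite: GrossLMS1991, §3–§4 (4.1)] [cite: WZhang2014, §3.7] -/
theorem exists_squarefree_allShallow_level_nonempty [NeZero (W.conductorNorm ℤ)] (hCM : W.HasCM) (hin : CMInert W 2)
    {K : Type} [Field K] [NumberField K] (hK : IsImaginaryQuadratic K) (hodd : Odd (NumberField.discr K))
    (hH : SatisfiesHeegnerHypothesis (W.conductorNorm ℤ) K)
    (Dt : ModularParametrizationData W (W.conductorNorm ℤ)) {β : ℤ} (ι : K →+* ℂ)
    (d₁ : KolyvaginHeegnerData Dt β ι 1) (r B : ℕ) :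
    ∃ n : ℕ, Squarefree n ∧ n.primeFactors.card = r ∧
      (∀ q ∈ n.primeFactors, B < q ∧ Zhang2014.IsKolyvaginPrime (W.conductorNorm ℤ) W K 2 q ∧ CMInert W q ∧
        Zhang2014.kolyvaginIndex W 2 q = 1 ∧ q % 4 = 1) ∧
      Nonempty (KolyvaginHeegnerData Dt β ι n) := by
  obtain ⟨n, hn, hcard, hall⟩ := exists_squarefree_allShallow_level W hCM hin hK hodd r B
  exact ⟨n, hn, hcard, hall,
    nonempty_kolyvaginHeegnerData_of_kolyvaginPrimes W hK hH Dt ι d₁ hn (fun q hq ↦ (hall q hq).2.1)⟩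

/-- **On H₂, at every such level the crux's clause is ONE genus-twist statement for every datum** (p801497 at a supplied
level): for all `r, B` there is a square-free all-shallow admissible level `n` (`r` prime factors `> B`, data inhabited) such
that for EVERY datum `d` of conductor `n`: `P_d(n) ∉ 2E(K[n]) ⟺ ¬ ∃ Q, (∀ ℓ ∣ n, σ_ℓ²Q = Q ∧ σ_ℓQ = −Q) ∧ 2Q = G_d`,
`G_d = Σ_{s∈S} s(𝒩_n y(n))` the genus trace. [cite: GrossLMS1991, §3 (3.5), Prop. 3.7 (1), §4 (4.1)] [cite: WZhang2014, §3.7] -/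
theorem exists_squarefree_allShallow_level_anti_form [NeZero (W.conductorNorm ℤ)] (hCM : W.HasCM) (hin : CMInert W 2)
    (hρ : W.HasSurjectiveModNGaloisRep (2 : ℤ))
    {K : Type} [Field K] [NumberField K] (hK : IsImaginaryQuadratic K) (hodd : Odd (NumberField.discr K))
    (h3 : NumberField.discr K ≠ -3) (hH : SatisfiesHeegnerHypothesis (W.conductorNorm ℤ) K)
    (Dt : ModularParametrizationData W (W.conductorNorm ℤ)) {β : ℤ} (ι : K →+* ℂ)
    (d₁ : KolyvaginHeegnerData Dt β ι 1) (r B : ℕ) :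
    ∃ n : ℕ, Squarefree n ∧ n.primeFactors.card = r ∧
      (∀ q ∈ n.primeFactors, B < q ∧ Zhang2014.IsKolyvaginPrime (W.conductorNorm ℤ) W K 2 q ∧ CMInert W q ∧
        Zhang2014.kolyvaginIndex W 2 q = 1 ∧ q % 4 = 1) ∧
      Nonempty (KolyvaginHeegnerData Dt β ι n) ∧
      ∀ d : KolyvaginHeegnerData Dt β ι n,
        ((¬ ∃ Q : (W.baseChange (ringClassField K ι n)).toAffine.Point, (2 : ℤ) • Q = d.derivedPoint) ↔
          ¬ ∃ Q : (W.baseChange (ringClassField K ι n)).toAffine.Point,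
            (∀ ℓ ∈ n.primeFactors, pointGalHom W (ringClassField K ι n) (d.σ ℓ ^ 2) Q = Q ∧
              pointGalHom W (ringClassField K ι n) (d.σ ℓ) Q = -Q) ∧ (2 : ℤ) • Q =
              ∑ s ∈ d.S, pointGalHom W (ringClassField K ι n) s
                (n.primeFactorsList.foldr
                  (fun q x ↦ ∑ k ∈ Finset.range ((q + 1) / 2),
                    pointGalHom W (ringClassField K ι n) ((d.σ q ^ 2) ^ k) x) d.y)) := by
  obtain ⟨n, hn, hcard, hall, hne⟩ := exists_squarefree_allShallow_level_nonempty W hCM hin hK hodd hH Dt ι d₁ r B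
  refine ⟨n, hn, hcard, hall, hne, fun d ↦ not_congr ?_⟩
  exact two_dvd_derivedPoint_iff_exists_forall_anti_of_allShallow W hCM hin hρ hK hodd h3 hH hn
    (fun q hq ↦ ⟨(hall q hq).2.1, (hall q hq).2.2.1⟩) (fun q hq ↦ (hall q hq).2.2.2.2) d

end Summit.BirchSwinnertonDyer.BirchSwinnertonDyer.Theorems.CMKolyvaginConjecturePositiveDepth

end
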